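import Literature.Computability.AlgebraicComplexity.KIReductionCodes
import Literature.Computability.Complexity.ListFoldBricks
import HarnessLib

/-!
# Reading a polynomial off ANY string: the junk-tolerant semantics of integer circuit codes, with
# degree and height bounds (input of the randomised identity test behind BIJL18 Thm. 5)

The code words `circuitWord m C = ⟨bin m, ⟨⟨1^{#gates}, encList (gate codes)⟩, opCode output⟩⟩` of
division-free integer circuits (`ValiantBooleanBridge.lean`, spelled out in `KIReductionCodes.lean`:
sum gate `0 · ⟨1^{#args}, encList [⟨intCode c, opCode u⟩ …]⟩`, product gate `1 · ⟨1^{#args}, …⟩`,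
operands `00·bin k` (variable), `01·intCode c` (constant), `1·bin j` (gate reference)) are here read
TOTALLY — every string `w` denotes a circuit `rdCircuit V w` over `V` variables (junk-tolerant
projections `fstF`/`sndF`, list decoder `Brick.decNil`, variable indices `≥ V` read as the constant
`0`) — so that a randomised identity test built from the same projections is analysable on every
input (Schwartz 1980 / Ibarra–Moran 1983: the zero test of straight-line programs; consumer:
`CircuitCodeModularEvaluator.lean`, the `FP` evaluator modulo a random number, and BIJL18 Thm. 5).

* `rdInt`, `rdOp`, `rdGate`, `rdGateCodes`, `rdCircuit`, **`semPoly w`** (the polynomial of the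
  circuit read off `w`, in `|w|` variables);
* **reading is decoding on genuine codes**: `rdCircuit_circuitWord` (`= C.rename (Fin.castLE _)` when
  `m ≤ V`), hence `semPoly_circuitWord_eq_zero_iff : semPoly (circuitWord m C) = 0 ↔ C.eval = 0`
  for `m ≤ |circuitWord m C|`;
* **bounds for every string** `w` of length `L`: `totalDegree_semPoly_le` (`deg ≤ 2^{L²}`) and
  `natAbs_eval_semPoly_le` (`|semPoly w (a)| ≤ 2^{2^{L²+3L}·(B+1)}` at integer points with
  coordinates in `[0, 2^B)`), by the gate-by-gate recursions `deg ≤ L · deg`,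
  `log|value| ≤ L · log|value| + 2L` (`#gates, fan-in, log|constants| ≤ L`).

## References

* J. T. Schwartz, J. ACM 27 (1980), §3; O. H. Ibarra, S. Moran, J. ACM 30 (1983), §4 (zero testing of
  straight-line programs by modular evaluation) [Schwartz1980] [IbarraMoran1983].
* V. Kabanets, R. Impagliazzo, Comput. Complexity 13 (2004), §2 (circuits as strings)
  [KabanetsImpagliazzo2004].
* M. Bläser, C. Ikenmeyer, G. Jindal, V. Lysikov, STOC 2018, Lemma 25 (value bounds)
  [BlaserIkenmeyerJindalLysikov2018].
-/

noncomputable section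

namespace Literature.Computability.AlgebraicComplexity

namespace CircuitCode

open _root_.Computability Complexity Brick ArithCircuit KIReduction MvPolynomial

/-! ### The junk-tolerant reader -/

/-- The integer read off a code `⟨[sign], magnitude⟩` (`intCode`): the value of the second field,
negated when the first field starts with `1`. [cite: KabanetsImpagliazzo2004, §2] -/
def rdInt (c : List Bool) : ℤ :=
  if (fstF c).headD false then -(bitsToNat (sndF c) : ℤ) else (bitsToNat (sndF c) : ℤ)

/-- The operand over `V` variables read off a code: `1·u ↦ gate ⟦u⟧`, `01·c ↦ const (rdInt c)`,
`00·u ↦ var ⟦u⟧` if `⟦u⟧ < V`, else the constant `0`. [cite: KabanetsImpagliazzo2004, §2] -/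
def rdOp (V : ℕ) (u : List Bool) : Operand ℤ (Fin V) :=
  if u.headD false then .gate (bitsToNat u.tail)
  else if u.tail.headD false then .const (rdInt u.tail.tail)
  else if h : bitsToNat u.tail.tail < V then .var ⟨bitsToNat u.tail.tail, h⟩ else .const 0

/-- The argument codes of a gate code `tag · ⟨count, encList items⟩`. [cite: KabanetsImpagliazzo2004, §2] -/
def rdItems (g : List Bool) : List (List Bool) := decNil (sndF g.tail)

/-- The gate read off a code: tag `1` = product of the operands `rdOp` of the items, tag `0` = sum of
`(rdInt (fstF item)) • rdOp (sndF item)`. [cite: KabanetsImpagliazzo2004, §2] -/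
def rdGate (V : ℕ) (g : List Bool) : Gate ℤ (Fin V) :=
  if g.headD false then .prod ((rdItems g).map (rdOp V))
  else .sum ((rdItems g).map fun it => (rdInt (fstF it), rdOp V (sndF it)))

/-- The gate codes of a word `⟨hdr, ⟨⟨count, encList gates⟩, out⟩⟩`. [cite: KabanetsImpagliazzo2004, §2] -/
def rdGateCodes (w : List Bool) : List (List Bool) := decNil (sndF (fstF (sndF w)))

/-- The output operand code of a word. [cite: KabanetsImpagliazzo2004, §2] -/
def rdOutCode (w : List Bool) : List Bool := sndF (sndF w)

/-- **The circuit over `V` variables read off an arbitrary string.** [cite: KabanetsImpagliazzo2004, §2] -/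
def rdCircuit (V : ℕ) (w : List Bool) : ArithCircuit ℤ (Fin V) :=
  ⟨(rdGateCodes w).map (rdGate V), rdOp V (rdOutCode w)⟩

/-- **The polynomial of a string**: the polynomial computed by the circuit read off `w`, over
`|w|` variables (written `X.eval |w|` for the consumer's polynomial bookkeeping).
[cite: Schwartz1980, §3] -/
def semPoly (w : List Bool) : MvPolynomial (Fin (Polynomial.X.eval w.length)) ℤ :=
  (rdCircuit (Polynomial.X.eval w.length) w).eval

/-! ### Reading genuine codes -/

/-- `rdInt` decodes `intCode`. [cite: KabanetsImpagliazzo2004, §2] -/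
theorem rdInt_intCode (z : ℤ) : rdInt (intCode z) = z := by
  rw [QuantumComplexity.BosonCodes.intCode_eq, rdInt, fstF_boolPair, sndF_boolPair, bitsToNat_encodeNat]
  by_cases hz : z < 0
  · simp only [hz, decide_true, List.headD_cons, if_true]
    omega
  · simp only [hz, decide_false, List.headD_cons]
    simp only [Bool.false_eq_true, if_false]
    omega

/-- `rdOp` decodes `opCode` (variables renamed along `Fin m ↪ Fin V`). [cite: KabanetsImpagliazzo2004, §2] -/
theorem rdOp_opCode {m V : ℕ} (h : m ≤ V) (u : Operand ℤ (Fin m)) :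
    rdOp V (opCode m u) = u.rename (Fin.castLE h) := by
  cases u with
  | var i =>
    have hi : bitsToNat (encodeNat i.val) < V := by rw [bitsToNat_encodeNat]; omega
    simp only [opCode_var, rdOp, List.headD_cons, List.tail_cons, Bool.false_eq_true, if_false, hi,
      dif_pos, Operand.rename]
    congr 1
    ext
    simp [bitsToNat_encodeNat]
  | const c => simp [rdOp, Operand.rename, rdInt_intCode]
  | gate j => simp [rdOp, Operand.rename, bitsToNat_encodeNat]

/-- `rdGate` decodes `gateCode`. [cite: KabanetsImpagliazzo2004, §2] -/
theorem rdGate_gateCode {m V : ℕ} (h : m ≤ V) (g : Gate ℤ (Fin m)) :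
    rdGate V (gateCode m g) = g.rename (Fin.castLE h) := by
  cases g with
  | sum args =>
    simp only [gateCode_sum, rdGate, rdItems, List.headD_cons, Bool.false_eq_true, if_false, List.tail_cons,
      sndF_boolPair, decNil_encList, List.map_map, Gate.rename]
    congr 1
    refine List.map_congr_left fun a _ => ?_
    simp [rdInt_intCode, rdOp_opCode h]
  | prod args =>
    simp only [gateCode_prod, rdGate, rdItems, List.headD_cons, if_true, List.tail_cons, sndF_boolPair,
      decNil_encList, List.map_map, Gate.rename]
    congr 1
    exact List.map_congr_left fun a _ => by simp [rdOp_opCode h]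

/-- The gate codes of a circuit word are the codes of its gates. [cite: KabanetsImpagliazzo2004, §2] -/
theorem rdGateCodes_circuitWord {m : ℕ} (C : ArithCircuit ℤ (Fin m)) :
    rdGateCodes (circuitWord m C) = C.gates.map (gateCode m) := by
  rw [rdGateCodes, circuitWord, encodeArithCircuit_eq]
  simp

/-- The output code of a circuit word. [cite: KabanetsImpagliazzo2004, §2] -/
theorem rdOutCode_circuitWord {m : ℕ} (C : ArithCircuit ℤ (Fin m)) :
    rdOutCode (circuitWord m C) = opCode m C.output := by
  rw [rdOutCode, circuitWord, encodeArithCircuit_eq]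
  simp

/-- **Reading a circuit word is decoding it**: `rdCircuit V (circuitWord m C) = C.rename (Fin.castLE h)`
for `m ≤ V`. [cite: KabanetsImpagliazzo2004, §2] -/
theorem rdCircuit_circuitWord {m V : ℕ} (h : m ≤ V) (C : ArithCircuit ℤ (Fin m)) :
    rdCircuit V (circuitWord m C) = C.rename (Fin.castLE h) := by
  simp only [rdCircuit, rdGateCodes_circuitWord, rdOutCode_circuitWord, List.map_map, rdOp_opCode h,
    ArithCircuit.rename]
  congr 1
  exact List.map_congr_left fun g _ => by simp [rdGate_gateCode h]

/-- **The polynomial of a circuit word vanishes iff the circuit computes zero**, provided the word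
is long enough to host the variables (`m ≤ |circuitWord m C|`). [cite: Schwartz1980, §3] -/
theorem semPoly_circuitWord_eq_zero_iff {m : ℕ} (C : ArithCircuit ℤ (Fin m))
    (h : m ≤ (circuitWord m C).length) : semPoly (circuitWord m C) = 0 ↔ C.eval = 0 := by
  have h' : m ≤ Polynomial.X.eval (circuitWord m C).length := by rwa [Polynomial.eval_X]
  rw [semPoly, rdCircuit_circuitWord h', eval_rename_apply]
  exact MvPolynomial.rename_injective _ (Fin.castLE_injective h') |>.eq_iff' (by simp)

/-! ### Structural size facts of the reading -/

/-- A gate code read off `w` is at most half as long as `w`'s gate list, so shorter than `w` (the list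
code doubles every item). [cite: KabanetsImpagliazzo2004, §2 (circuits as strings)] -/
theorem length_le_of_mem_rdGateCodes {w g : List Bool} (hg : g ∈ rdGateCodes w) : g.length ≤ w.length := by
  have h1 := two_mul_length_le_of_mem_decNil hg
  have h2 := length_fstF_sndF_le w
  have h3 := length_fstF_sndF_le (sndF w)
  have h4 := length_fstF_sndF_le (fstF (sndF w))
  omega

/-- At most `|w|` gates are read off `w`. [cite: KabanetsImpagliazzo2004, §2 (circuits as strings)] -/
theorem length_rdGateCodes_le (w : List Bool) : (rdGateCodes w).length ≤ w.length := by
  have h1 := length_decNil_le (sndF (fstF (sndF w)))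
  have h2 := length_fstF_sndF_le w
  have h3 := length_fstF_sndF_le (sndF w)
  have h4 := length_fstF_sndF_le (fstF (sndF w))
  rw [rdGateCodes]; omega

/-- A gate code has at most `|g|` argument items. [cite: KabanetsImpagliazzo2004, §2 (circuits as strings)] -/
theorem length_rdItems_le (g : List Bool) : (rdItems g).length ≤ g.length := by
  have h1 := length_decNil_le (sndF g.tail)
  have h2 := length_fstF_sndF_le g.tail
  have h3 : g.tail.length ≤ g.length := by simp
  rw [rdItems]; omega

/-- An item of a gate code is shorter than the gate code. [cite: KabanetsImpagliazzo2004, §2 (circuits as strings)] -/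
theorem length_le_of_mem_rdItems {g it : List Bool} (h : it ∈ rdItems g) : it.length ≤ g.length := by
  have h1 := two_mul_length_le_of_mem_decNil h
  have h2 := length_fstF_sndF_le g.tail
  have h3 : g.tail.length ≤ g.length := by simp
  omega

/-- The integer read off `c` has magnitude `< 2^{|c|}` (binary magnitude). [cite: KabanetsImpagliazzo2004, §2 (circuits as strings)] -/
theorem natAbs_rdInt_lt (c : List Bool) : (rdInt c).natAbs < 2 ^ c.length := by
  have h1 := bitsToNat_lt (sndF c)
  have h2 := length_fstF_sndF_le c
  have h3 : 2 ^ (sndF c).length ≤ 2 ^ c.length := Nat.pow_le_pow_right (by norm_num) (by omega)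
  unfold rdInt
  split_ifs <;> simpa using h1.trans_le h3

/-! ### The degree bound -/

section Degree

variable {V : ℕ}

/-- The total degree of a list sum is bounded by a common bound of the summands. [folklore] -/
private theorem totalDegree_list_sum_le {l : List (MvPolynomial (Fin V) ℤ)} {D : ℕ}
    (h : ∀ p ∈ l, p.totalDegree ≤ D) : l.sum.totalDegree ≤ D := by
  induction l with
  | nil => simp
  | cons a l ih =>
    rw [List.sum_cons]
    refine (totalDegree_add a l.sum).trans (max_le (h a (by simp)) (ih fun p hp => h p (by simp [hp])))

/-- The degree of an operand value: `≤ D` if every earlier value has degree `≤ D` and `1 ≤ D`. [folklore] -/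
private theorem totalDegree_operand_le {vals : List (MvPolynomial (Fin V) ℤ)} {D : ℕ} (hD : 1 ≤ D)
    (hvals : ∀ p ∈ vals, p.totalDegree ≤ D) (u : Operand ℤ (Fin V)) : (u.eval vals).totalDegree ≤ D := by
  cases u with
  | var i => simpa [Operand.eval] using hD
  | const c =>
    change (C c : MvPolynomial (Fin V) ℤ).totalDegree ≤ D
    rw [totalDegree_C]; exact Nat.zero_le _
  | gate j =>
    simp only [Operand.eval, List.getD_eq_getElem?_getD]
    cases hj : vals[j]? with
    | none => simp
    | some p => simpa using hvals p (List.mem_of_getElem? hj)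

/-- **One read gate multiplies degrees by at most its length** (`≤ L`, a bound on its fan-in): if all
earlier values have degree `≤ D` (`D ≥ 1`) and the gate code has length `≤ L`, its value has degree
`≤ L · D`. [folklore] -/
private theorem totalDegree_rdGate_le {vals : List (MvPolynomial (Fin V) ℤ)} {D L : ℕ} (hD : 1 ≤ D)
    (hvals : ∀ p ∈ vals, p.totalDegree ≤ D) {g : List Bool} (hg : g.length ≤ L) :
    ((rdGate V g).eval vals).totalDegree ≤ L * D := by
  rcases Nat.eq_zero_or_pos L with rfl | hL
  · have : g = [] := List.length_eq_zero_iff.1 (Nat.le_zero.1 hg)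
    subst this
    simp [rdGate, rdItems, Gate.eval]
  have hLD : D ≤ L * D := Nat.le_mul_of_pos_left D hL
  unfold rdGate
  split_ifs with htag
  · -- product gate
    simp only [Gate.eval, List.map_map]
    refine (totalDegree_list_prod _).trans ?_
    rw [List.map_map]
    have hlen := (length_rdItems_le g).trans hg
    calc ((rdItems g).map (totalDegree ∘ ((fun u => u.eval vals) ∘ rdOp V))).sum
        ≤ ((rdItems g).map fun _ => D).sum := List.sum_le_sum fun it _ =>
            totalDegree_operand_le hD hvals _
      _ = (rdItems g).length * D := by rw [List.map_const', List.sum_replicate, smul_eq_mul]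
      _ ≤ L * D := Nat.mul_le_mul_right D hlen
  · -- sum gate
    simp only [Gate.eval, List.map_map]
    refine hLD.trans' (totalDegree_list_sum_le fun p hp => ?_)
    obtain ⟨it, -, rfl⟩ := List.mem_map.1 hp
    exact (totalDegree_smul_le _ _).trans (totalDegree_operand_le hD hvals _)

/-- **All gate values read off gate codes of length `≤ L` (`L ≥ 1`) have degree `≤ L^{#gates}`.** [folklore] -/
private theorem totalDegree_gateValues_le {L : ℕ} (hL : 1 ≤ L) :
    ∀ (codes : List (List Bool)), (∀ g ∈ codes, g.length ≤ L) →
      ∀ p ∈ gateValues (codes.map (rdGate V)), p.totalDegree ≤ L ^ codes.length := by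
  intro codes
  induction codes using List.reverseRecOn with
  | nil => intro _ p hp; simp [gateValues] at hp
  | append_singleton codes g ih =>
    intro hlen p hp
    rw [List.map_append, List.map_singleton, gateValues_append_singleton, List.mem_append,
      List.mem_singleton] at hp
    have ih' := ih fun g' hg' => hlen g' (List.mem_append_left _ hg')
    have hpow : L ^ codes.length ≤ L ^ (codes ++ [g]).length :=
      Nat.pow_le_pow_right hL (by simp)
    rcases hp with hp | rfl
    · exact (ih' p hp).trans hpow
    · rw [List.length_append, List.length_singleton, pow_succ, mul_comm]
      exact totalDegree_rdGate_le (Nat.one_le_pow _ _ hL) ih' (hlen g (by simp))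

/-- **Degree bound for the polynomial of an arbitrary string**: `deg (semPoly w) ≤ 2^{|w|²}`
(`≤ |w|^{|w|}`: at most `|w|` gates, each of fan-in `≤ |w|`). [cite: Schwartz1980, §3] -/
theorem totalDegree_semPoly_le (w : List Bool) :
    (semPoly w).totalDegree ≤ 2 ^ (Polynomial.X ^ 2 : Polynomial ℕ).eval w.length := by
  set L := w.length with hL
  simp only [Polynomial.eval_pow, Polynomial.eval_X]
  rcases Nat.eq_zero_or_pos L with hL0 | hLpos
  · -- the empty word reads as the empty circuit with output operand `00·ε`
    have hw : w = [] := List.length_eq_zero_iff.1 (hL ▸ hL0)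
    subst hw
    simp [semPoly, rdCircuit, rdGateCodes, rdOutCode, ArithCircuit.eval, rdOp, Operand.eval,
      sndF, fstF, boolUnpair]
  · have hvals := totalDegree_gateValues_le (V := Polynomial.X.eval w.length) hLpos (rdGateCodes w)
      fun g hg => length_le_of_mem_rdGateCodes hg
    have hout := totalDegree_operand_le (Nat.one_le_pow _ _ hLpos) hvals (rdOp _ (rdOutCode w))
    refine hout.trans ?_
    calc L ^ (rdGateCodes w).length ≤ L ^ L := Nat.pow_le_pow_right hLpos (length_rdGateCodes_le w)
      _ ≤ (2 ^ L) ^ L := Nat.pow_le_pow_left (Nat.lt_two_pow_self).le L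
      _ = 2 ^ (L ^ 2) := by rw [← pow_mul, sq]

end Degree

/-! ### The height bound -/

section Height

variable {V : ℕ} (a : Fin V → ℤ)

/-- A list sum of terms of absolute value `≤ M` has absolute value `≤ #terms · M`. [folklore] -/
private theorem abs_list_sum_le {α : Type*} (l : List α) (f : α → ℤ) {M : ℤ} (h : ∀ x ∈ l, |f x| ≤ M) :
    |(l.map f).sum| ≤ l.length * M := by
  induction l with
  | nil => simp
  | cons x l ih =>
    rw [List.map_cons, List.sum_cons, List.length_cons, Nat.cast_succ, add_mul, one_mul, add_comm (_ * M)]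
    exact (abs_add_le _ _).trans (add_le_add (h x (by simp)) (ih fun y hy => h y (by simp [hy])))

/-- A list product of terms of absolute value `≤ M` has absolute value `≤ M ^ #terms`. [folklore] -/
private theorem abs_list_prod_le {α : Type*} (l : List α) (f : α → ℤ) {M : ℤ} (h : ∀ x ∈ l, |f x| ≤ M) :
    |(l.map f).prod| ≤ M ^ l.length := by
  induction l with
  | nil => simp
  | cons x l ih =>
    rw [List.map_cons, List.prod_cons, List.length_cons, pow_succ, abs_mul, mul_comm]
    exact mul_le_mul (ih fun y hy => h y (by simp [hy])) (h x (by simp)) (abs_nonneg _)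
      ((abs_nonneg _).trans (h x (by simp)) |>.trans' le_rfl |> fun h0 => pow_nonneg ((abs_nonneg _).trans (h x (by simp))) _)

/-- The value of a read operand of length `≤ L`: `≤ 2^e` when the variables are `< 2^B ≤ 2^e`, the
earlier values are `≤ 2^e` and `L ≤ e` (constants have fewer than `L` bits). [folklore] -/
private theorem abs_eval_rdOp_le {vals : List (MvPolynomial (Fin V) ℤ)} {B L e : ℕ} (he : L + B ≤ e)
    (ha : ∀ i, |a i| < 2 ^ B) (hvals : ∀ p ∈ vals, |MvPolynomial.eval a p| ≤ 2 ^ e) {u : List Bool}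
    (hu : u.length ≤ L) : |MvPolynomial.eval a ((rdOp V u).eval vals)| ≤ 2 ^ e := by
  have h2e : (2 : ℤ) ^ B ≤ 2 ^ e := pow_le_pow_right₀ (by norm_num) (by omega)
  have h2L : (2 : ℤ) ^ L ≤ 2 ^ e := pow_le_pow_right₀ (by norm_num) (by omega)
  unfold rdOp
  split_ifs with h1 h2 h3
  · -- gate reference
    simp only [Operand.eval, List.getD_eq_getElem?_getD]
    cases hj : vals[bitsToNat u.tail]? with
    | none => simp
    | some p => simpa using hvals p (List.mem_of_getElem? hj)
  · -- constant
    simp only [Operand.eval, eval_C]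
    have hc := natAbs_rdInt_lt u.tail.tail
    have hlen : u.tail.tail.length ≤ L := by simp; omega
    have hc' : |rdInt u.tail.tail| < 2 ^ L := by
      rw [Int.abs_eq_natAbs]
      exact_mod_cast hc.trans_le (Nat.pow_le_pow_right (by norm_num) hlen)
    exact hc'.le.trans h2L
  · -- variable
    simp only [Operand.eval, eval_X]
    exact (ha _).le.trans h2e
  · -- out-of-range variable
    simp [Operand.eval]

/-- **One read gate of length `≤ L`**: if the earlier values are `≤ 2^e` (`L + B ≤ e`), its value is
`≤ 2^{L e + 2L}` (sum: `≤ L · 2^L · 2^e`; product: `≤ (2^e)^L`). [folklore] -/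
private theorem abs_eval_rdGate_le {vals : List (MvPolynomial (Fin V) ℤ)} {B L e : ℕ} (he : L + B ≤ e)
    (ha : ∀ i, |a i| < 2 ^ B) (hvals : ∀ p ∈ vals, |MvPolynomial.eval a p| ≤ 2 ^ e) {g : List Bool}
    (hg : g.length ≤ L) : |MvPolynomial.eval a ((rdGate V g).eval vals)| ≤ 2 ^ (L * e + 2 * L) := by
  rcases Nat.eq_zero_or_pos L with rfl | hL1
  · have : g = [] := List.length_eq_zero_iff.1 (Nat.le_zero.1 hg)
    subst this
    simp [rdGate, rdItems, Gate.eval]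
  have hitems : (rdItems g).length ≤ L := (length_rdItems_le g).trans hg
  have hop : ∀ it ∈ rdItems g, |MvPolynomial.eval a ((rdOp V (sndF it)).eval vals)| ≤ 2 ^ e :=
    fun it hit => abs_eval_rdOp_le a he ha hvals (by
      have := length_le_of_mem_rdItems hit; have := length_fstF_sndF_le it; omega)
  unfold rdGate
  split_ifs with htag
  · -- product
    simp only [Gate.eval, List.map_map, map_list_prod]
    refine (abs_list_prod_le (rdItems g) _ (M := 2 ^ e) fun it hit => ?_).trans ?_
    · exact abs_eval_rdOp_le a he ha hvals ((length_le_of_mem_rdItems hit).trans hg)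
    · rw [← pow_mul]
      exact pow_le_pow_right₀ (by norm_num) (by nlinarith)
  · -- sum
    simp only [Gate.eval, List.map_map, map_list_sum]
    have hterm : ∀ it ∈ rdItems g,
        |(MvPolynomial.eval a ∘ ((fun p : ℤ × Operand ℤ (Fin V) => p.1 • p.2.eval vals) ∘
          fun it => (rdInt (fstF it), rdOp V (sndF it)))) it| ≤ 2 ^ L * 2 ^ e := by
      intro it hit
      simp only [Function.comp_apply, smul_eq_C_mul, map_mul, eval_C, abs_mul]
      refine mul_le_mul ?_ (hop it hit) (abs_nonneg _) (by positivity)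
      have hc := natAbs_rdInt_lt (fstF it)
      have hlen : (fstF it).length ≤ L := by
        have := length_le_of_mem_rdItems hit; have := length_fstF_sndF_le it; omega
      rw [Int.abs_eq_natAbs]
      exact_mod_cast (hc.trans_le (Nat.pow_le_pow_right (by norm_num) hlen)).le
    refine (abs_list_sum_le (rdItems g) _ hterm).trans ?_
    have hL : ((rdItems g).length : ℤ) ≤ 2 ^ L := by
      have : (rdItems g).length ≤ 2 ^ L := hitems.trans (Nat.lt_two_pow_self).le
      exact_mod_cast this
    calc ((rdItems g).length : ℤ) * (2 ^ L * 2 ^ e) ≤ 2 ^ L * (2 ^ L * 2 ^ e) :=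
          mul_le_mul_of_nonneg_right hL (by positivity)
      _ = 2 ^ (e + 2 * L) := by rw [← pow_add, ← pow_add]; congr 1; omega
      _ ≤ 2 ^ (L * e + 2 * L) := pow_le_pow_right₀ (by norm_num) (by nlinarith)

/-- The exponents of the recursion: `e_i = (3L)^i (L + B + 1)`. [folklore] -/
private def hexp (L B i : ℕ) : ℕ := (3 * L) ^ i * (L + B + 1)

/-- The recursion step `L e_i + 2L ≤ e_{i+1}` (`L ≥ 1`). [folklore] -/
private theorem hexp_step {L : ℕ} (hL : 1 ≤ L) (B i : ℕ) : L * hexp L B i + 2 * L ≤ hexp L B (i + 1) := by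
  unfold hexp
  have h1 : 1 ≤ (3 * L) ^ i * (L + B + 1) := Nat.one_le_iff_ne_zero.2 (by positivity)
  rw [pow_succ]
  nlinarith

/-- **All gate values read off codes of length `≤ L` (`L ≥ 1`) are `≤ 2^{e_{#gates}}`.** [folklore] -/
private theorem abs_eval_gateValues_le {B L : ℕ} (hL : 1 ≤ L) (ha : ∀ i, |a i| < 2 ^ B) :
    ∀ (codes : List (List Bool)), (∀ g ∈ codes, g.length ≤ L) →
      ∀ p ∈ gateValues (codes.map (rdGate V)), |MvPolynomial.eval a p| ≤ 2 ^ hexp L B codes.length := by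
  intro codes
  induction codes using List.reverseRecOn with
  | nil => intro _ p hp; simp [gateValues] at hp
  | append_singleton codes g ih =>
    intro hlen p hp
    rw [List.map_append, List.map_singleton, gateValues_append_singleton, List.mem_append,
      List.mem_singleton] at hp
    have ih' := ih fun g' hg' => hlen g' (List.mem_append_left _ hg')
    have hmono : (2 : ℤ) ^ hexp L B codes.length ≤ 2 ^ hexp L B (codes ++ [g]).length := by
      refine pow_le_pow_right₀ (by norm_num) ?_
      rw [List.length_append, List.length_singleton]
      have := hexp_step hL B codes.length
      nlinarith
    rcases hp with hp | rfl
    · exact (ih' p hp).trans hmono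
    · have he : L + B ≤ hexp L B codes.length := by
        unfold hexp
        have : 1 ≤ (3 * L) ^ codes.length := Nat.one_le_pow _ _ (by omega)
        nlinarith
      refine (abs_eval_rdGate_le a he ha ih' (hlen g (by simp))).trans (pow_le_pow_right₀ (by norm_num) ?_)
      rw [List.length_append, List.length_singleton]
      exact hexp_step hL B codes.length

/-- `(3L)^L (L + B + 1) ≤ 2^{L² + 3L} (B + 1)`. [folklore] -/
private theorem hexp_le (L B : ℕ) : hexp L B L ≤ 2 ^ (L ^ 2 + 3 * L) * (B + 1) := by
  unfold hexp
  have h3 : 3 * L ≤ 2 ^ (L + 2) := by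
    have := (Nat.lt_two_pow_self (n := L)).le; rw [pow_add]; omega
  have h1 : (3 * L) ^ L ≤ 2 ^ (L ^ 2 + 2 * L) := by
    calc (3 * L) ^ L ≤ (2 ^ (L + 2)) ^ L := Nat.pow_le_pow_left h3 L
      _ = 2 ^ (L ^ 2 + 2 * L) := by rw [← pow_mul]; congr 1; ring
  have h2 : L + B + 1 ≤ 2 ^ L * (B + 1) := by
    have := Nat.lt_two_pow_self (n := L); nlinarith [Nat.zero_le (L * B)]
  calc (3 * L) ^ L * (L + B + 1) ≤ 2 ^ (L ^ 2 + 2 * L) * (2 ^ L * (B + 1)) := Nat.mul_le_mul h1 h2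
    _ = 2 ^ (L ^ 2 + 3 * L) * (B + 1) := by rw [← mul_assoc, ← pow_add]; congr 2; ring

end Height

/-- **Height bound for the polynomial of an arbitrary string**: at an integer point with coordinates
of absolute value `< 2^B`, `|semPoly w (a)| ≤ 2^{2^{|w|² + 3|w|} · (B + 1)}` (`≤ |w|` gates of fan-in
`≤ |w|` with constants of `≤ |w|` bits: `log₂|value|` grows by `v ↦ |w| v + 2|w|` per gate).
[cite: BlaserIkenmeyerJindalLysikov2018, Lemma 25] -/
theorem natAbs_eval_semPoly_le (w : List Bool) {B : ℕ} (pt : Fin (Polynomial.X.eval w.length) → ℤ)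
    (ha : ∀ i, |pt i| < 2 ^ B) :
    (MvPolynomial.eval pt (semPoly w)).natAbs ≤
      2 ^ (2 ^ (Polynomial.X ^ 2 + Polynomial.C 3 * Polynomial.X : Polynomial ℕ).eval w.length * (B + 1)) := by
  have hpoly : (Polynomial.X ^ 2 + Polynomial.C 3 * Polynomial.X : Polynomial ℕ).eval w.length =
      w.length ^ 2 + 3 * w.length := by simp
  rw [hpoly]
  rcases Nat.eq_zero_or_pos w.length with hL0 | hLpos
  · have hw : w = [] := List.length_eq_zero_iff.1 hL0
    subst hw
    simp [semPoly, rdCircuit, rdGateCodes, rdOutCode, ArithCircuit.eval, rdOp, Operand.eval,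
      sndF, fstF, boolUnpair]
  · have hvals := abs_eval_gateValues_le pt hLpos ha (rdGateCodes w)
      fun g hg => length_le_of_mem_rdGateCodes hg
    have he : w.length + B ≤ hexp w.length B (rdGateCodes w).length := by
      unfold hexp
      have : 1 ≤ (3 * w.length) ^ (rdGateCodes w).length := Nat.one_le_pow _ _ (by omega)
      nlinarith
    have hout := abs_eval_rdOp_le pt he ha hvals (u := rdOutCode w)
      (by have := length_fstF_sndF_le w; have := length_fstF_sndF_le (sndF w); rw [rdOutCode]; omega)
    have hfin : hexp w.length B (rdGateCodes w).length ≤ 2 ^ (w.length ^ 2 + 3 * w.length) * (B + 1) := by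
      refine le_trans ?_ (hexp_le w.length B)
      unfold hexp
      exact Nat.mul_le_mul_right _ (Nat.pow_le_pow_right (by omega) (length_rdGateCodes_le w))
    have h := hout.trans (pow_le_pow_right₀ (by norm_num) hfin)
    have h' : ((MvPolynomial.eval pt (semPoly w)).natAbs : ℤ) ≤
        (2 : ℤ) ^ (2 ^ (w.length ^ 2 + 3 * w.length) * (B + 1)) :=
      (Int.natCast_natAbs _).trans_le h
    exact_mod_cast h'

end CircuitCode

end Literature.Computability.AlgebraicComplexity

end
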